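import Summits.AtomisticToContinuum.Crystallization.Theorems.OverbindingBudgetEnergyForceRows
import Summits.AtomisticToContinuum.Crystallization.Theorems.OverbindingBudgetEnergyAffineStraightening

/-!
# OverbindingBudget · decomp-a2c lens-4 g35 — part XXIII-Z₂: GEO-OSC decomposed — `StackedHeightsOsc` ⟸ COARSE-REG ∧ FORCE-CERT (seam PROVED)

Helper file under `--supports stmt-AtomisticToContinuum-31280` (RDEF = `Theses.OverbindingBudget.RobustDefectLimitWindows`); closes nothing.

GEO-OSC `…EnergyAffineStraightening.StackedHeightsOsc Λ₁ ω` (cone XXXVII's last per-configuration energy leaf: the gap heights of an admissible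
stacked configuration lie in a band of width `≤ ω`) is cut into
* COARSE-REG-T `CoarseRegistryT Λ₁ h₀ τ₀` / COARSE-REG-S `CoarseRegistryS Λ₁ h₁ τ₁` [GEOMETRY·S/M, WEAKER]: the increments of an admissible T-type
  (S-type) configuration are, increment by increment and up to lattice drifts, within `τ₀` of the EXPLICIT two-valued profile `{hol a b + h₀ n,
  rotPi n (hol a b + h₀ n)}` (of the one-valued `holSq a b + h₁ n`) — the registry side's R3geo `RegistryGeometryW` with the pinning DROPPED and the
  positive unit normal as INPUT (part Z₃ `registryGeometryW_of_coarse`: it implies R3geo over every box `[s₁, s₂]` with `289 s₂² ≤ 388 s₁²`);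
* FORCE-CERT-T `ForceCertT h₀ τ₀ τ' ω₀` / FORCE-CERT-S `ForceCertS h₁ τ₁ τ' ω₀` [finite CERT·S, configuration-FREE, INSTRUMENTABLE]: per cell `(a, b, n)`
  of the clean family (`27/32 ≤ ‖a‖ ≤ 17/16`, `|‖b‖ − ‖a‖| ≤ ‖a‖/7`, lattice vectors `≥ 9/10`, T- resp. S-type) a fine reference increment `ĉ⋆`
  within `τ'` of the coarse centre and a CHAIN of `K` certified stages (part Z₁'s `StageT`/`StageS` rows + `Budget`) contracting the deviation box
  `(τ₀ + τ', τ₀ + τ')` down to height half-width `ω₀`.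
★★ `stackedHeightsOsc_of_coarse_cert`: for `Λ₁ ≤ 17/16` and `2ω₀ ≤ ω` the four leaves imply `StackedHeightsOsc Λ₁ ω` — PROVED: lens-3's
`stackedUniform` makes the cell T-type or S-type and supplies the clean-family bounds; COARSE-REG writes `incr w m = ĉ m + e m + lattice` with
`‖e m‖ ≤ τ₀ + τ'` round the FINE references (`rotPi n` is an isometry fixing heights); part Z₁'s `devs_within_of_chain` runs the certified stages
(adjacent rows at `ĉ m ∈ {ĉ⋆, rotPi n ĉ⋆}`, far rows at the word offsets `j ĉ⋆ + (s − j) rotPi n ĉ⋆`); all heights end within `ω₀` of `⟪ĉ⋆, n⟫`.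
-/

namespace Summit.AtomisticToContinuum.Crystallization.Theorems.OverbindingBudgetEnergyHeightsOsc

open Finset
open scoped RealInnerProductSpace
open Summit.AtomisticToContinuum.Crystallization.Theorems.OverbindingBudgetElasticSplitShear (StressFree)
open Summit.AtomisticToContinuum.Crystallization.Theorems.ChartedPlanarOrderChunkFloor (E3)
open Summit.AtomisticToContinuum.Crystallization.Theorems.ChartedPlanarOrderRigidityDoor (IsNash)
open Summit.AtomisticToContinuum.Crystallization.Theorems.ChartedPlanarOrderDensityDichotomy (μS IsSep)
open Summit.AtomisticToContinuum.Crystallization.Theorems.ChartedPlanarOrderDoorLayered (Layered)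
open Summit.AtomisticToContinuum.Crystallization.Theorems.ChartedPlanarOrderCleanScaleP (IsCleanP)
open Summit.AtomisticToContinuum.Crystallization.Theorems.ChartedPlanarOrderStackedUniform (stackedUniform)
open Summit.AtomisticToContinuum.Crystallization.Theorems.ChartedPlanarOrderProfileSlavingLJ (layerForce IsStacked gapStress incr)
open Summit.AtomisticToContinuum.Crystallization.Theorems.OverbindingBudgetScaleWidening (IsCleanW)
open Summit.AtomisticToContinuum.Crystallization.Theorems.OverbindingBudgetRegistryCut (rotPi hol IsUnitNormal reg inner_rotPi)
open Summit.AtomisticToContinuum.Crystallization.Theorems.OverbindingBudgetRegistrySquare (holSq regSq)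
open Summit.AtomisticToContinuum.Crystallization.Theorems.OverbindingBudgetRegistryDichotomy (IsTType IsSType)
open Summit.AtomisticToContinuum.Crystallization.Theorems.OverbindingBudgetEnergyStraightening (le_norm_latticeVec_of_isSep)
open Summit.AtomisticToContinuum.Crystallization.Theorems.OverbindingBudgetEnergyAffineStraightening (StackedHeightsOsc)
open Summit.AtomisticToContinuum.Crystallization.Theorems.OverbindingBudgetEnergyStraddleCount (span)
open Summit.AtomisticToContinuum.Crystallization.Theorems.OverbindingBudgetEnergyForceRows
  (lat norm_lat_le AdjRow FarRow Budget StageOn inner_incr_eq devs_within_of_chain)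

/-! ## §1 The per-cell stage formats (configuration-free) -/

/-- **a T-cell stage** at the fine reference `ĉ⋆ = cst`: a budget, adjacent rows at `cst` and `rotPi n cst`, far rows at every coset word
`j • cst + (s − j) • rotPi n cst`, `j ≤ s`, `2 ≤ s ≤ S`; input box `(τX, τU)`, output box `(ωX, ωU)`, lower height `hlo`. -/
def StageT (a b n cst : E3) (S : ℕ) (hlo τX τU ωX ωU : ℝ) : Prop :=
  ∃ (f ρ c c' : ℕ → ℝ) (Gn Gl C C' R₁ Θ rn rl : ℝ), Budget S ρ c c' hlo τX τU Gn Gl C C' R₁ Θ rn rl ωX ωU ∧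
    (∀ ĉ : E3, (ĉ = cst ∨ ĉ = rotPi n cst) → AdjRow a b n ĉ (∑ s ∈ Icc 2 S, (s : ℝ) * f s) τX τU Θ Gn rn Gl rl) ∧
    (∀ s : ℕ, 2 ≤ s → s ≤ S → ∀ j : ℕ, j ≤ s →
      FarRow a b n ((j : ℝ) • cst + ((s : ℝ) - j) • rotPi n cst) s (f s) (ρ s) (c s) (c' s) τX τU)

/-- **an S-cell stage** at the fine reference `cst`: adjacent rows at `cst`, far rows at `s • cst`. -/
def StageS (a b n cst : E3) (S : ℕ) (hlo τX τU ωX ωU : ℝ) : Prop :=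
  ∃ (f ρ c c' : ℕ → ℝ) (Gn Gl C C' R₁ Θ rn rl : ℝ), Budget S ρ c c' hlo τX τU Gn Gl C C' R₁ Θ rn rl ωX ωU ∧
    AdjRow a b n cst (∑ s ∈ Icc 2 S, (s : ℝ) * f s) τX τU Θ Gn rn Gl rl ∧
    (∀ s : ℕ, 2 ≤ s → s ≤ S → FarRow a b n ((s : ℝ) • cst) s (f s) (ρ s) (c s) (c' s) τX τU)

/-! ## §2 The leaves -/

/-- **COARSE-REG-T · `CoarseRegistryT Λ₁ h₀ τ₀`** [GEOMETRY·S/M]: an admissible stacked configuration (7d's binders verbatim) with a T-type cell and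
positive unit normal `n` is, increment by increment and up to lattice drifts, within `τ₀` of the two-valued registry profile centred at
`hol a b + h₀ • n` — R3geo `RegistryGeometryW` WITHOUT the pinning, normal as input.  Why it might fail: `τ₀` below the clean-W hollow registration
tolerance (`≈ 0.07` lateral) plus the height spread of unpinned T-cells round `h₀`; of record `(h₀, τ₀) ≈ (0.79, 3/20)`. [piece] -/
def CoarseRegistryT (Λ₁ h₀ τ₀ : ℝ) : Prop :=
  ∀ δ : ℝ, 0 < δ → ∀ (a b : E3) (w : ℤ → E3), IsStacked a b w → LinearIndependent ℝ ![a, b] →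
    ‖a‖ ≤ Λ₁ → ‖b‖ ≤ Λ₁ → IsSep δ (Layered a b w) → IsCleanW (μS (Layered a b w)) → IsNash (μS (Layered a b w)) →
    StressFree (Layered a b w) → (∀ m : ℤ, gapStress a b m (incr w) = 0) → IsTType a b →
    ∀ n : E3, IsUnitNormal a b n → (∀ m : ℤ, 0 < ⟪incr w m, n⟫) →
    ∃ (σ : ℤ → Bool) (u v : ℤ → ℤ), ∀ m : ℤ, ‖incr w m - reg a b n (hol a b + h₀ • n) σ u v m‖ ≤ τ₀

/-- **COARSE-REG-S · `CoarseRegistryS Λ₁ h₁ τ₁`** [GEOMETRY·S/M]: the same for S-type cells, round the one-valued square profile centred at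
`holSq a b + h₁ • n`.  Why it might fail: as COARSE-REG-T; of record `(h₁, τ₁) ≈ (0.69, 3/20)`. [piece] -/
def CoarseRegistryS (Λ₁ h₁ τ₁ : ℝ) : Prop :=
  ∀ δ : ℝ, 0 < δ → ∀ (a b : E3) (w : ℤ → E3), IsStacked a b w → LinearIndependent ℝ ![a, b] →
    ‖a‖ ≤ Λ₁ → ‖b‖ ≤ Λ₁ → IsSep δ (Layered a b w) → IsCleanW (μS (Layered a b w)) → IsNash (μS (Layered a b w)) →
    StressFree (Layered a b w) → (∀ m : ℤ, gapStress a b m (incr w) = 0) → IsSType a b →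
    ∀ n : E3, IsUnitNormal a b n → (∀ m : ℤ, 0 < ⟪incr w m, n⟫) →
    ∃ (u v : ℤ → ℤ), ∀ m : ℤ, ‖incr w m - regSq a b (holSq a b + h₁ • n) u v m‖ ≤ τ₁

/-- **FORCE-CERT-T · `ForceCertT h₀ τ₀ τ' ω₀`** [finite CERT·S, configuration-free]: for every independent T-type cell of the clean family
(`27/32 ≤ ‖a‖ ≤ 17/16`, `‖b‖ ≤ 17/16`, `|‖b‖ − ‖a‖| ≤ ‖a‖/7`, lattice vectors `≥ 9/10`) and unit normal `n`: a fine reference increment `ĉ⋆` within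
`τ'` of `hol a b + h₀ • n` and a chain of `K` T-cell stages with radii `τX k, τU k` (`τX 0, τU 0 ≥ τ₀ + τ'`, `τX K ≤ ω₀`), each with a lower height
`hlo k ≤ max (h₀ − τ₀) (⟪ĉ⋆, n⟫ − τX k)`.  Why it might fail: only numerically — in each stage the guard must dominate `R₁ + C τX + C' τU` where the
adjacent rows are not expansive, and `C < Gn`, `C' < Gl` (M-matrix); expected `K = 2`: radius `≈ 1/4 ↦ ≈ 2·10⁻³ ↦ ≈ 10⁻⁴`. [piece] -/
def ForceCertT (h₀ τ₀ τ' ω₀ : ℝ) : Prop :=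
  ∀ (a b n : E3), LinearIndependent ℝ ![a, b] → ‖a‖ ≤ 17 / 16 → ‖b‖ ≤ 17 / 16 → 27 / 32 ≤ ‖a‖ → |‖b‖ - ‖a‖| ≤ 1 / 7 * ‖a‖ →
    (∀ i j : ℤ, ((i : ℝ) • a + (j : ℝ) • b) ≠ 0 → 9 / 10 ≤ ‖(i : ℝ) • a + (j : ℝ) • b‖) → IsUnitNormal a b n → IsTType a b →
    ∃ (cst : E3) (K : ℕ) (S : ℕ → ℕ) (hlo τX τU : ℕ → ℝ), ‖cst - (hol a b + h₀ • n)‖ ≤ τ' ∧ τ₀ + τ' ≤ τX 0 ∧ τ₀ + τ' ≤ τU 0 ∧ τX K ≤ ω₀ ∧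
      ∀ k : ℕ, k < K → (hlo k ≤ h₀ - τ₀ ∨ hlo k ≤ ⟪cst, n⟫ - τX k) ∧ StageT a b n cst (S k) (hlo k) (τX k) (τU k) (τX (k + 1)) (τU (k + 1))

/-- **FORCE-CERT-S · `ForceCertS h₁ τ₁ τ' ω₀`** [finite CERT·S, configuration-free]: the same for S-type cells — fine reference within `τ'` of
`holSq a b + h₁ • n`, a chain of S-cell stages.  Why it might fail: as FORCE-CERT-T (the span-2 on-top pair at height `≈ 1.37` makes the S-type far
feedback `C` the larger one). [piece] -/
def ForceCertS (h₁ τ₁ τ' ω₀ : ℝ) : Prop :=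
  ∀ (a b n : E3), LinearIndependent ℝ ![a, b] → ‖a‖ ≤ 17 / 16 → ‖b‖ ≤ 17 / 16 → 27 / 32 ≤ ‖a‖ → |‖b‖ - ‖a‖| ≤ 1 / 7 * ‖a‖ →
    (∀ i j : ℤ, ((i : ℝ) • a + (j : ℝ) • b) ≠ 0 → 9 / 10 ≤ ‖(i : ℝ) • a + (j : ℝ) • b‖) → IsUnitNormal a b n → IsSType a b →
    ∃ (cst : E3) (K : ℕ) (S : ℕ → ℕ) (hlo τX τU : ℕ → ℝ), ‖cst - (holSq a b + h₁ • n)‖ ≤ τ' ∧ τ₁ + τ' ≤ τX 0 ∧ τ₁ + τ' ≤ τU 0 ∧ τX K ≤ ω₀ ∧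
      ∀ k : ℕ, k < K → (hlo k ≤ h₁ - τ₁ ∨ hlo k ≤ ⟪cst, n⟫ - τX k) ∧ StageS a b n cst (S k) (hlo k) (τX k) (τU k) (τX (k + 1)) (τU (k + 1))

/-! ## §3 Stages realised on a registry profile -/

variable {a b n : E3} {w : ℤ → E3} {δ : ℝ}

/-- a T-cell stage realises a stage on every two-valued reference profile `m ↦ cst / rotPi n cst`. [bookkeeping] -/
theorem stageOn_of_stageT {cst : E3} (σ : ℤ → Bool) {S : ℕ} {hlo τX τU ωX ωU : ℝ} (hST : StageT a b n cst S hlo τX τU ωX ωU) :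
    StageOn a b n (fun m => if σ m then cst else rotPi n cst) S hlo τX τU ωX ωU := by
  classical
  obtain ⟨f, ρ, c, c', Gn, Gl, C, C', R₁, Θ, rn, rl, hB, hADJ, hFAR⟩ := hST
  refine ⟨f, ρ, c, c', Gn, Gl, C, C', R₁, Θ, rn, rl, hB, fun m => ?_, fun k l hkl hs2 hsS => ?_⟩
  · simp only; split_ifs
    · exact hADJ cst (Or.inl rfl)
    · exact hADJ (rotPi n cst) (Or.inr rfl)
  · set j : ℕ := ((Ioc k l).filter fun i => σ i = true).card with hjdef
    have hcard : (Ioc k l).card = span (k, l) := by rw [Int.card_Ioc]; rfl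
    have hjle : j ≤ span (k, l) := by rw [hjdef, ← hcard]; exact card_filter_le _ _
    have hword : ∑ i ∈ Ioc k l, (fun m => if σ m then cst else rotPi n cst) i = (j : ℝ) • cst + ((span (k, l) : ℝ) - j) • rotPi n cst := by
      have e1 : ∑ i ∈ Ioc k l, (fun m => if σ m then cst else rotPi n cst) i = ∑ i ∈ Ioc k l, (if σ i = true then cst else rotPi n cst) :=
        sum_congr rfl fun i _ => rfl
      rw [e1, sum_ite, sum_const, sum_const, ← hjdef]
      have hc2 : (((Ioc k l).filter fun i => ¬σ i = true).card : ℝ) = (span (k, l) : ℝ) - j := by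
        have := card_filter_add_card_filter_not (s := Ioc k l) (fun i => σ i = true)
        rw [hcard] at this
        have h' : (j : ℝ) + (((Ioc k l).filter fun i => ¬σ i = true).card : ℝ) = span (k, l) := by
          rw [hjdef]; exact_mod_cast this
        linarith
      rw [← Nat.cast_smul_eq_nsmul ℝ, ← Nat.cast_smul_eq_nsmul ℝ, hc2]
    rw [hword]
    exact hFAR (span (k, l)) hs2 hsS j hjle

/-- an S-cell stage realises a stage on the constant reference profile. [bookkeeping] -/
theorem stageOn_of_stageS {cst : E3} {S : ℕ} {hlo τX τU ωX ωU : ℝ} (hST : StageS a b n cst S hlo τX τU ωX ωU) :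
    StageOn a b n (fun _ => cst) S hlo τX τU ωX ωU := by
  obtain ⟨f, ρ, c, c', Gn, Gl, C, C', R₁, Θ, rn, rl, hB, hADJ, hFAR⟩ := hST
  refine ⟨f, ρ, c, c', Gn, Gl, C, C', R₁, Θ, rn, rl, hB, fun _ => hADJ, fun k l hkl hs2 hsS => ?_⟩
  have hcard : ((Ioc k l).card : ℝ) = (span (k, l) : ℝ) := by rw [Int.card_Ioc]; simp [span]
  have hword : ∑ i ∈ Ioc k l, (fun _ : ℤ => cst) i = ((span (k, l) : ℕ) : ℝ) • cst := by
    simp only [sum_const]; rw [← Nat.cast_smul_eq_nsmul ℝ, hcard]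
  rw [hword]; exact hFAR (span (k, l)) hs2 hsS

/-! ## §4 ★ The seam: COARSE-REG ∧ FORCE-CERT ⟹ GEO-OSC -/

/-- `|⟪z, n⟫ − h| ≤ τ` when `‖z − r‖ ≤ τ` and `⟪r, n⟫ = h` (unit `n`). [bookkeeping] -/
theorem abs_inner_sub_le_of_near {n z r : E3} (hn : ‖n‖ = 1) {h τ : ℝ} (hr : ⟪r, n⟫ = h) (hz : ‖z - r‖ ≤ τ) : |⟪z, n⟫ - h| ≤ τ := by
  have := (norm_lat_le hn (z - r)).2
  rw [inner_sub_left, hr] at this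
  exact this.trans hz

/-- ★ the chain run on a configuration: decomposition, coarse box, lower heights ⟹ all heights within `τX K` of `h⋆`. [this file] -/
theorem heights_within_of_cert (hδ : 9 / 10 ≤ δ) (hab : LinearIndependent ℝ ![a, b]) (hst : IsStacked a b w)
    (hS : IsSep δ (Layered a b w)) (hn : IsUnitNormal a b n) (ha : ‖a‖ ≤ 17 / 16) (hb : ‖b‖ ≤ 17 / 16)
    (h0 : ∀ m : ℤ, gapStress a b m (incr w) = 0) (hpos : ∀ m : ℤ, 0 < ⟪incr w m, n⟫)
    {ĉ e : ℤ → E3} {u v : ℤ → ℤ} {hstar hlow τ : ℝ} {K : ℕ} {S : ℕ → ℕ} {hlo τX τU : ℕ → ℝ}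
    (hdec : ∀ m : ℤ, incr w m = ĉ m + e m + ((((u m : ℤ) : ℝ)) • a + (((v m : ℤ) : ℝ)) • b))
    (hh : ∀ m : ℤ, ⟪ĉ m, n⟫ = hstar) (henorm : ∀ m : ℤ, ‖e m‖ ≤ τ) (hτX : τ ≤ τX 0) (hτU : τ ≤ τU 0)
    (hband : ∀ m : ℤ, hlow ≤ ⟪incr w m, n⟫) (hhlo : ∀ k : ℕ, k < K → hlo k ≤ hlow ∨ hlo k ≤ hstar - τX k)
    (hCH : ∀ k : ℕ, k < K → StageOn a b n ĉ (S k) (hlo k) (τX k) (τU k) (τX (k + 1)) (τU (k + 1))) (m : ℤ) :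
    |⟪incr w m, n⟫ - hstar| ≤ τX K := by
  have hn1 : ‖n‖ = 1 := hn.1
  have hP : ∀ m : ℤ, ⟪incr w m, n⟫ = hstar + ⟪e m, n⟫ := fun m => by rw [inner_incr_eq hn hdec m, hh m]
  have he0 : ∀ m : ℤ, |⟪e m, n⟫| ≤ τX 0 ∧ ‖lat n (e m)‖ ≤ τU 0 := fun m =>
    ⟨((norm_lat_le hn1 (e m)).2.trans (henorm m)).trans hτX, ((norm_lat_le hn1 (e m)).1.trans (henorm m)).trans hτU⟩
  have hhlo' : ∀ k : ℕ, k < K → ∀ m : ℤ, |⟪e m, n⟫| ≤ τX k → hlo k ≤ ⟪incr w m, n⟫ := by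
    intro k hk m hem
    rcases hhlo k hk with h1 | h1
    · exact h1.trans (hband m)
    · rw [hP m]; rw [abs_le] at hem; linarith [hem.1]
  have key := devs_within_of_chain hδ hab hst hS hn ha hb h0 hpos hdec he0 hhlo' hCH m
  rw [hP m, add_sub_cancel_left]; exact key.1

/-- the T-branch of the seam. -/
theorem heights_within_T {Λ₁ h₀ τ₀ τ' ω₀ : ℝ} (hΛ₁ : Λ₁ ≤ 17 / 16) (hCR : CoarseRegistryT Λ₁ h₀ τ₀) (hFC : ForceCertT h₀ τ₀ τ' ω₀)
    (hδ : 9 / 10 ≤ δ) (hst : IsStacked a b w) (hab : LinearIndependent ℝ ![a, b]) (ha : ‖a‖ ≤ Λ₁) (hb : ‖b‖ ≤ Λ₁)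
    (hS : IsSep δ (Layered a b w)) (hc : IsCleanW (μS (Layered a b w))) (hna : IsNash (μS (Layered a b w)))
    (hf : StressFree (Layered a b w)) (h0 : ∀ m : ℤ, gapStress a b m (incr w) = 0) (hT : IsTType a b)
    (halo : 27 / 32 ≤ ‖a‖) (hba : |‖b‖ - ‖a‖| ≤ 1 / 7 * ‖a‖)
    (hn : IsUnitNormal a b n) (hpos : ∀ m : ℤ, 0 < ⟪incr w m, n⟫) :
    ∃ hstar : ℝ, ∀ m : ℤ, |⟪incr w m, n⟫ - hstar| ≤ ω₀ := by
  have hδ0 : 0 < δ := by linarith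
  have hlat : ∀ i j : ℤ, ((i : ℝ) • a + (j : ℝ) • b) ≠ 0 → 9 / 10 ≤ ‖(i : ℝ) • a + (j : ℝ) • b‖ := fun i j hij =>
    hδ.trans (le_norm_latticeVec_of_isSep hS i j hij)
  obtain ⟨σ, u, v, hreg⟩ := hCR δ hδ0 a b w hst hab ha hb hS hc hna hf h0 hT n hn hpos
  obtain ⟨cst, K, S, hlo, τX, τU, hcst, hτX, hτU, hKω, hCH⟩ := hFC a b n hab (ha.trans hΛ₁) (hb.trans hΛ₁) halo hba hlat hn hT
  have hn1 : ‖n‖ = 1 := hn.1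
  have han : ⟪a, n⟫ = 0 := (real_inner_comm n a).trans hn.2.1
  have hbn : ⟪b, n⟫ = 0 := (real_inner_comm n b).trans hn.2.2
  -- heights of the coarse centre and of the fine reference
  have hhol : ⟪hol a b, n⟫ = 0 := by
    unfold hol; split_ifs <;> simp [inner_smul_left, inner_add_left, inner_sub_left, han, hbn]
  have hc0n : ⟪hol a b + h₀ • n, n⟫ = h₀ := by
    rw [inner_add_left, hhol, inner_smul_left, real_inner_self_eq_norm_sq, hn1]; simp
  set hstar : ℝ := ⟪cst, n⟫ with hstar_def
  have hrot : ⟪rotPi n cst, n⟫ = hstar := by rw [real_inner_comm, inner_rotPi hn1]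
  -- the reference increments and the deviations
  set ĉ : ℤ → E3 := fun m => if σ m then cst else rotPi n cst with hĉdef
  set ĉ₀ : ℤ → E3 := fun m => if σ m then hol a b + h₀ • n else rotPi n (hol a b + h₀ • n) with hĉ₀def
  set e : ℤ → E3 := fun m => incr w m - ĉ m - ((((u m : ℤ) : ℝ)) • a + (((v m : ℤ) : ℝ)) • b) with hedef
  have hdec : ∀ m : ℤ, incr w m = ĉ m + e m + ((((u m : ℤ) : ℝ)) • a + (((v m : ℤ) : ℝ)) • b) := by
    intro m; rw [hedef]; simp only; abel
  have hh : ∀ m : ℤ, ⟪ĉ m, n⟫ = hstar := by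
    intro m; rw [hĉdef]; simp only; split_ifs
    · rfl
    · exact hrot
  -- `‖ĉ m - ĉ₀ m‖ ≤ τ'` (rotPi is an isometry) and `‖incr w m - (ĉ₀ m + lattice)‖ ≤ τ₀`
  have hrotiso : ∀ z : E3, ‖rotPi n z‖ = ‖z‖ := by
    intro z
    have e1 : ‖rotPi n z‖ ^ 2 = ‖z‖ ^ 2 := by
      unfold rotPi
      rw [norm_sub_sq_real, norm_smul, hn1, mul_one, inner_smul_left, real_inner_comm, Real.norm_eq_abs, sq_abs]
      simp only [RCLike.conj_to_real]; ring
    nlinarith [norm_nonneg (rotPi n z), norm_nonneg z]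
  have hrotsub : ∀ y z : E3, rotPi n y - rotPi n z = rotPi n (y - z) := by
    intro y z; unfold rotPi; rw [inner_sub_left]; module
  have hĉĉ₀ : ∀ m : ℤ, ‖ĉ m - ĉ₀ m‖ ≤ τ' := by
    intro m; rw [hĉdef, hĉ₀def]; simp only; split_ifs
    · exact hcst
    · rw [hrotsub, hrotiso]; exact hcst
  have hereg : ∀ m : ℤ, incr w m - reg a b n (hol a b + h₀ • n) σ u v m = e m + (ĉ m - ĉ₀ m) := by
    intro m; rw [hedef, hĉdef, hĉ₀def]; unfold reg; simp only; split_ifs <;> abel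
  have henorm : ∀ m : ℤ, ‖e m‖ ≤ τ₀ + τ' := by
    intro m
    have h1 : e m = (incr w m - reg a b n (hol a b + h₀ • n) σ u v m) - (ĉ m - ĉ₀ m) := by rw [hereg]; abel
    rw [h1]; exact (norm_sub_le _ _).trans (add_le_add (hreg m) (hĉĉ₀ m))
  -- lower height bound from the coarse profile
  have hĉ₀h : ∀ m : ℤ, ⟪ĉ₀ m, n⟫ = h₀ := by
    intro m; rw [hĉ₀def]; simp only; split_ifs
    · exact hc0n
    · rw [real_inner_comm, inner_rotPi hn1, hc0n]
  have hband : ∀ m : ℤ, h₀ - τ₀ ≤ ⟪incr w m, n⟫ := by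
    intro m
    have hr : ⟪reg a b n (hol a b + h₀ • n) σ u v m, n⟫ = h₀ := by
      have : reg a b n (hol a b + h₀ • n) σ u v m = ĉ₀ m + ((((u m : ℤ) : ℝ)) • a + (((v m : ℤ) : ℝ)) • b) := by
        rw [hĉ₀def]; unfold reg; simp only
      rw [this, inner_add_left, hĉ₀h, inner_add_left, inner_smul_left, inner_smul_left, han, hbn]; simp
    have := abs_inner_sub_le_of_near hn1 hr (hreg m)
    rw [abs_le] at this; linarith [this.1]
  exact ⟨hstar, fun m => (heights_within_of_cert (S := S) hδ hab hst hS hn (ha.trans hΛ₁) (hb.trans hΛ₁) h0 hpos hdec hh henorm hτX hτU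
    hband (fun k hk => (hCH k hk).1) (fun k hk => stageOn_of_stageT σ (hCH k hk).2) m).trans hKω⟩

/-- the S-branch of the seam. -/
theorem heights_within_S {Λ₁ h₁ τ₁ τ' ω₀ : ℝ} (hΛ₁ : Λ₁ ≤ 17 / 16) (hCR : CoarseRegistryS Λ₁ h₁ τ₁) (hFC : ForceCertS h₁ τ₁ τ' ω₀)
    (hδ : 9 / 10 ≤ δ) (hst : IsStacked a b w) (hab : LinearIndependent ℝ ![a, b]) (ha : ‖a‖ ≤ Λ₁) (hb : ‖b‖ ≤ Λ₁)
    (hS : IsSep δ (Layered a b w)) (hc : IsCleanW (μS (Layered a b w))) (hna : IsNash (μS (Layered a b w)))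
    (hf : StressFree (Layered a b w)) (h0 : ∀ m : ℤ, gapStress a b m (incr w) = 0) (hT : IsSType a b)
    (halo : 27 / 32 ≤ ‖a‖) (hba : |‖b‖ - ‖a‖| ≤ 1 / 7 * ‖a‖)
    (hn : IsUnitNormal a b n) (hpos : ∀ m : ℤ, 0 < ⟪incr w m, n⟫) :
    ∃ hstar : ℝ, ∀ m : ℤ, |⟪incr w m, n⟫ - hstar| ≤ ω₀ := by
  have hδ0 : 0 < δ := by linarith
  have hlat : ∀ i j : ℤ, ((i : ℝ) • a + (j : ℝ) • b) ≠ 0 → 9 / 10 ≤ ‖(i : ℝ) • a + (j : ℝ) • b‖ := fun i j hij =>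
    hδ.trans (le_norm_latticeVec_of_isSep hS i j hij)
  obtain ⟨u, v, hreg⟩ := hCR δ hδ0 a b w hst hab ha hb hS hc hna hf h0 hT n hn hpos
  obtain ⟨cst, K, S, hlo, τX, τU, hcst, hτX, hτU, hKω, hCH⟩ := hFC a b n hab (ha.trans hΛ₁) (hb.trans hΛ₁) halo hba hlat hn hT
  have hn1 : ‖n‖ = 1 := hn.1
  have han : ⟪a, n⟫ = 0 := (real_inner_comm n a).trans hn.2.1
  have hbn : ⟪b, n⟫ = 0 := (real_inner_comm n b).trans hn.2.2
  have hc0n : ⟪holSq a b + h₁ • n, n⟫ = h₁ := by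
    unfold holSq
    rw [inner_add_left, inner_smul_left, inner_add_left, han, hbn, inner_smul_left, real_inner_self_eq_norm_sq, hn1]; simp
  set hstar : ℝ := ⟪cst, n⟫ with hstar_def
  set e : ℤ → E3 := fun m => incr w m - cst - ((((u m : ℤ) : ℝ)) • a + (((v m : ℤ) : ℝ)) • b) with hedef
  have hdec : ∀ m : ℤ, incr w m = (fun _ : ℤ => cst) m + e m + ((((u m : ℤ) : ℝ)) • a + (((v m : ℤ) : ℝ)) • b) := by
    intro m; rw [hedef]; simp only; abel
  have hereg : ∀ m : ℤ, incr w m - regSq a b (holSq a b + h₁ • n) u v m = e m + (cst - (holSq a b + h₁ • n)) := by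
    intro m; rw [hedef]; unfold regSq; simp only; abel
  have henorm : ∀ m : ℤ, ‖e m‖ ≤ τ₁ + τ' := by
    intro m
    have h1 : e m = (incr w m - regSq a b (holSq a b + h₁ • n) u v m) - (cst - (holSq a b + h₁ • n)) := by rw [hereg]; abel
    rw [h1]; exact (norm_sub_le _ _).trans (add_le_add (hreg m) hcst)
  have hband : ∀ m : ℤ, h₁ - τ₁ ≤ ⟪incr w m, n⟫ := by
    intro m
    have hr : ⟪regSq a b (holSq a b + h₁ • n) u v m, n⟫ = h₁ := by
      unfold regSq
      rw [inner_add_left, hc0n, inner_add_left, inner_smul_left, inner_smul_left, han, hbn]; simp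
    have := abs_inner_sub_le_of_near hn1 hr (hreg m)
    rw [abs_le] at this; linarith [this.1]
  exact ⟨hstar, fun m => (heights_within_of_cert (S := S) hδ hab hst hS hn (ha.trans hΛ₁) (hb.trans hΛ₁) h0 hpos hdec (fun _ => rfl) henorm
    hτX hτU hband (fun k hk => (hCH k hk).1) (fun k hk => stageOn_of_stageS (hCH k hk).2) m).trans hKω⟩

/-- ★★ **THE SEAM: COARSE-REG-T ∧ FORCE-CERT-T ∧ COARSE-REG-S ∧ FORCE-CERT-S ⟹ GEO-OSC `StackedHeightsOsc Λ₁ ω`** for `Λ₁ ≤ 17/16`, `2ω₀ ≤ ω`: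
by lens-3's `stackedUniform` the cell is T-type or S-type and lies in the clean family; in either case the certified chain puts every gap height
within `ω₀` of the fine reference height. [this file] -/
theorem stackedHeightsOsc_of_coarse_cert {Λ₁ h₀ τ₀ τ' h₁ τ₁ τ'' ω₀ ω : ℝ} (hΛ₁ : Λ₁ ≤ 17 / 16) (hω : 2 * ω₀ ≤ ω)
    (hCT : CoarseRegistryT Λ₁ h₀ τ₀) (hFT : ForceCertT h₀ τ₀ τ' ω₀) (hCS : CoarseRegistryS Λ₁ h₁ τ₁) (hFS : ForceCertS h₁ τ₁ τ'' ω₀) :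
    StackedHeightsOsc Λ₁ ω := by
  intro δ hδ a b w hst hab ha hb hs hc hna hf hz n hn hpos
  have hδ0 : (0 : ℝ) < δ := by linarith
  have hc' : IsCleanP (103 / 100) (μS (Layered a b w)) := hc
  obtain ⟨ν, -, -, -, -, halo, hba, -, hTS⟩ :=
    stackedUniform (by norm_num : (103 / 100 : ℝ) ≤ 8 / 7) hδ0 hs hc' hst (ha.trans hΛ₁) (hb.trans hΛ₁)
  have key : ∃ hstar : ℝ, ∀ m : ℤ, |⟪incr w m, n⟫ - hstar| ≤ ω₀ := by
    rcases hTS with ⟨hT', -⟩ | ⟨hS', -⟩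
    · exact heights_within_T hΛ₁ hCT hFT hδ hst hab ha hb hs hc hna hf hz hT' halo hba hn hpos
    · exact heights_within_S hΛ₁ hCS hFS hδ hst hab ha hb hs hc hna hf hz hS' halo hba hn hpos
  obtain ⟨hstar, hm⟩ := key
  refine ⟨hstar - ω₀, hstar + ω₀, by linarith, fun m => ?_⟩
  have := hm m; rw [abs_le] at this; constructor <;> linarith [this.1, this.2]

end Summit.AtomisticToContinuum.Crystallization.Theorems.OverbindingBudgetEnergyHeightsOsc
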